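import Literature.Computability.AlgebraicComplexity.MS21ANFThm35OfMonomialInclusion
import HarnessLib

/-!
# Medini–Shpilka 2021, Thm 35 (`thm:pitRoanf`) in every characteristic: the typed statement from
# Lemma 5.12 and the STRUCTURE LEMMA for `ANF_Δ ∘ M`

The characteristic-free repair of [MediniShpilka2021, Lemma 5.13] (registry B36, seat t18 g5's
blueprint `np/t18g5-MS21-thm35-B36-hasse-blueprint.md`, stages S1–S4 in flight, seats t18 / t17)
is the **structure lemma**, stated UPSTAIRS on `ANF_Δ`:

> for `M ∈ GL_{4^Δ}(K)`: if `Δ²_{M e_j} ANF_Δ = 0` for every column `j` and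
> `Σ_{a,a'} M_{aj} M_{a'j'} ∂_a∂_{a'} ANF_Δ = 0` for every pair `(j, j')` with `∂_j∂_{j'} ANF_Δ = 0`,
> then `mon(ANF_Δ(My)) ⊆ mon(ANF_Δ)`

(`hstruct` below, verbatim the induction-hypothesis binder of seat t17 g5's cut
`np/t17g5-B36-downstream-cut-signature.lean.txt`).  By the chain rules `hasseD_affSubst_refl`,
`pderiv_pderiv_affSubst_refl` and the injectivity of `q ↦ q(My)` these hypotheses say exactly that
every second-order Hasse operator killing `ANF_Δ` kills `ANF_Δ(My)`; so the contrapositive of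
`hstruct` is the disjunctive separation brick `h513H` of `MS2021.thm35Core_of_bricks_hasse`
(`h513H_of_structureLemma`).  Consequently (`MS2021_thm_35_of_h512_hstruct`):

  `MS2021_thm_35` follows from Lemma 5.12 (`h512`, seat p1 g5) and the structure lemma (`hstruct`)
  for every field and depth — the Lemma 5.14/5.15 engine (seat t24 g5) and everything else being in
  the tree.

Theorems only (no definitions, no new named facts, D-0026).  HONEST FRAMING: `h512` and `hstruct`
are NOT proved here; `MS2021_thm_35` is NOT discharged here.  `VP ≠ VNP` is NOT proved and nothing
in this file bears on it.

## References
* [MediniShpilka2021] D. Medini, A. Shpilka, CCC 2021 (LIPIcs 200:19) = arXiv:2102.05632: Thm 35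
  (CCC p.19:13; arXiv p0008:L29–30), proof §5.2 (p0030:L28–p0031:L24), Lemma 5.13 (p0029:L3–L13).
-/

noncomputable section

open MvPolynomial
open scoped Matrix

namespace Literature.Computability.AlgebraicComplexity

namespace MS2021

section Glue

variable {K : Type} [Field K]

/-- `q ↦ q(My)` (`affSubst le_rfl M 0`) is injective for `M` invertible: `q(My) = 0 ⇒ q = 0`.
[cite: MediniShpilka2021, §1.1.6 (CCC p.19:9)] -/
theorem eq_zero_of_affSubst_refl_eq_zero {N : ℕ} {M : Matrix (Fin N) (Fin N) K} (hM : IsUnit M.det)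
    {q : MvPolynomial (Fin N) K} (h : affSubst le_rfl M 0 q = 0) : q = 0 := by
  by_contra hq
  exact affSubst_ne_zero le_rfl hM 0 hq h

/-- **The disjunctive separation brick `h513H` from the structure lemma (contrapositive).**
[cite: MediniShpilka2021, Lemma 5.13 (arXiv p0029:L3–L13), characteristic-free form] -/
theorem h513H_of_structureLemma (Δ : ℕ)
    (hstruct : ∀ N : Matrix (Fin (4 ^ Δ)) (Fin (4 ^ Δ)) K, IsUnit N.det →
      (∀ j, hasseD 2 (fun a => N a j) (anf K Δ) = 0) →
      (∀ j j', pderiv j (pderiv j' (anf K Δ)) = 0 →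
        (∑ a, ∑ a', C (N a j * N a' j') * pderiv a (pderiv a' (anf K Δ))) = 0) →
      (affSubst le_rfl N 0 (anf K Δ)).support ⊆ (anf K Δ).support)
    (M : Matrix (Fin (4 ^ Δ)) (Fin (4 ^ Δ)) K) (hM : IsUnit M.det)
    (hsub : ¬ (affSubst le_rfl M 0 (anf K Δ)).support ⊆ (anf K Δ).support) :
    (∃ i j, pderiv i (pderiv j (anf K Δ)) = 0 ∧
        pderiv i (pderiv j (affSubst le_rfl M 0 (anf K Δ))) ≠ 0) ∨
      (∃ k, hasseD 2 (Pi.single k 1) (affSubst le_rfl M 0 (anf K Δ)) ≠ 0) := by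
  classical
  by_contra h
  push Not at h
  obtain ⟨hmixed, hhasse⟩ := h
  apply hsub (hstruct M hM ?_ ?_)
  · intro j
    have h1 := hhasse j
    rw [hasseD_affSubst_refl] at h1
    have hdir : (fun a : Fin (4 ^ Δ) => ∑ i, M a i * (Pi.single j 1 : Fin (4 ^ Δ) → K) i) =
        fun a => M a j := by
      funext a
      rw [Finset.sum_eq_single j (fun i _ hi => by rw [Pi.single_eq_of_ne hi, mul_zero])
        (fun h => absurd (Finset.mem_univ j) h), Pi.single_eq_same, mul_one]
    rw [hdir] at h1
    exact eq_zero_of_affSubst_refl_eq_zero hM h1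
  · intro j j' hjj'
    have h1 := hmixed j j' hjj'
    rw [pderiv_pderiv_affSubst_refl] at h1
    exact eq_zero_of_affSubst_refl_eq_zero hM h1

end Glue

end MS2021

/-! ### `MS2021_thm_35` from Lemma 5.12 and the structure lemma -/

section Packaging

open MS2021

/-- **MS Thm 35 (all fields, all depths) from Lemma 5.12 (`h512`) and the characteristic-free
structure lemma (`hstruct`)** — everything else (Cases `Δ₁ ≠ Δ₂`, A, B2, the diagonal Lemma
pitRoanfSame, the Lemma 5.14/5.15 engine, the Hasse plumbing) is in the tree.
[cite: MediniShpilka2021, Thm 35 (CCC p.19:13; arXiv p0008:L29-30); proof §5.2 (arXiv p0030:L28–p0031:L24)] -/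
theorem MS2021_thm_35_of_h512_hstruct
    (h512 : ∀ (K : Type) [Field K] (Δ : ℕ) (M : Matrix (Fin (4 ^ Δ)) (Fin (4 ^ Δ)) K),
      IsUnit M.det → (affSubst le_rfl M 0 (anf K Δ)).support ⊆ (anf K Δ).support →
      ∃ (π : Equiv.Perm (Fin (4 ^ Δ))) (α : Fin (4 ^ Δ) → K), (∀ i, α i ≠ 0) ∧
        rename π (anf K Δ) = anf K Δ ∧
        affSubst le_rfl M 0 (anf K Δ) = aeval (fun i => C (α i) * X (π i)) (anf K Δ))
    (hstruct : ∀ (K : Type) [Field K] (Δ : ℕ) (N : Matrix (Fin (4 ^ Δ)) (Fin (4 ^ Δ)) K),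
      IsUnit N.det → (∀ j, hasseD 2 (fun a => N a j) (anf K Δ) = 0) →
      (∀ j j', pderiv j (pderiv j' (anf K Δ)) = 0 →
        (∑ a, ∑ a', C (N a j * N a' j') * pderiv a (pderiv a' (anf K Δ))) = 0) →
      (affSubst le_rfl N 0 (anf K Δ)).support ⊆ (anf K Δ).support) :
    MS2021_thm_35 :=
  MS2021_thm_35_of_h512_h513H h512 fun K _ Δ M hM hsub =>
    h513H_of_structureLemma Δ (hstruct K Δ) M hM hsub

/-- Per-field form: MS Thm 35 at `(K, Δ, Δ)` from `h512` and `hstruct` at `(K, Δ)`.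
[cite: MediniShpilka2021, Thm 35 (CCC p.19:13; arXiv p0008:L29-30)] -/
theorem MS2021_thm_35_sameDepth_of_h512_hstruct (K : Type) [Field K] (Δ : ℕ)
    (h512 : ∀ (M : Matrix (Fin (4 ^ Δ)) (Fin (4 ^ Δ)) K), IsUnit M.det →
      (affSubst le_rfl M 0 (anf K Δ)).support ⊆ (anf K Δ).support →
      ∃ (π : Equiv.Perm (Fin (4 ^ Δ))) (α : Fin (4 ^ Δ) → K), (∀ i, α i ≠ 0) ∧
        rename π (anf K Δ) = anf K Δ ∧
        affSubst le_rfl M 0 (anf K Δ) = aeval (fun i => C (α i) * X (π i)) (anf K Δ))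
    (hstruct : ∀ N : Matrix (Fin (4 ^ Δ)) (Fin (4 ^ Δ)) K, IsUnit N.det →
      (∀ j, hasseD 2 (fun a => N a j) (anf K Δ) = 0) →
      (∀ j j', pderiv j (pderiv j' (anf K Δ)) = 0 →
        (∑ a, ∑ a', C (N a j * N a' j') * pderiv a (pderiv a' (anf K Δ))) = 0) →
      (affSubst le_rfl N 0 (anf K Δ)).support ⊆ (anf K Δ).support) (n c : ℕ) :
    ∀ f₁ ∈ affOrbit n (anf K Δ), ∀ f₂ ∈ affOrbit n (anf K Δ), f₁ - f₂ ≠ 0 →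
      ∀ G : Fin n → MvPolynomial (Fin (2 * max Δ Δ + 7) × (Fin c ⊕ Unit)) K,
        IsIndependent (2 * max Δ Δ + 7) G → IsUniform G → bind₁ G (f₁ - f₂) ≠ 0 :=
  MS2021_thm_35_sameDepth_of_bricks_hasse K Δ h512
    (fun M hM hsub => h513H_of_structureLemma Δ hstruct M hM hsub)
    (fun _ _ _ _ α hα h _ hA b ht G hG hB =>
      bind₁_affSubst_sum_C_mul_pderiv_pderiv_anf_ne_zero α hα h hA b ht G hG hB) n c

end Packaging

end Literature.Computability.AlgebraicComplexity

end
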